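import Summits.Parity.GeneralizedHardyLittlewood.Theses.FordMaynardSieveConst01651
import Summits.Parity.GeneralizedHardyLittlewood.Theorems.FordMaynardSieveConst01651SieveConst01651LinePart11
import HarnessLib

/-!
# Route `FordMaynardSieveConst01651` — target item `SieveConst01651` (stmt-Parity-19185), BY NAME

`SieveConst01651 := Literature.NumberTheory.Sieve.FordMaynard.LowerSieveThresholdAt (1651/10000)`: for every
`ν ∈ [0.1651, 1/3)` some `c > 0` is an admissible lower-bound linear-sieve constant at `(γ, θ, ν) = (1/2, 0, ν)` in the
Ford–Maynard framework (arXiv:2407.14368, Theorem 7.3 (a) with the programme's LP-refined cone-data witness `coneCert` at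
`ν₀ = 0.1651`; the printed three-line `g` of (8.2 b) reaches only `ν ≥ 0.1663` — rung F-P1 of Parity, D-0061; NOT the summit
Statement, zero summit credit).

The line skeleton `sieve_decomposition` (v21, `linewriter-parity-smallroutes-1`; re-homed as
`…Theorems.FordMaynardSieveConst01651SieveConst01651LineDefs` + `…LinePart01–11`) composes the target from its three registered stubs
(`SieveConst01651_of_v21`), all landed: `stub_signClauseFive` (p834287, hand `fordmaynardsieveco-2` g2/g3: the dimension-5
sign clause of `coneCert` by a kernel-evaluated type checker), `stub_certValuePos` (p837763, hands `fordmaynardsieveco-2` g3/g4: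
`0 < V(ν₀, coneCert)` by a log-free Buchstab/Volterra exact-integer certificate evaluated in the kernel), `stub_typeIIRegion`
(p833045, hand `fordmaynardsieveco-3` g0: FM Proposition 7.19 at `P = (1/2, 0, ν)`).  This file is the one-line composition.
Standard axioms only; no `native_decide`.
-/

noncomputable section

namespace Summit.Parity.GeneralizedHardyLittlewood.Theses.FordMaynardSieveConst01651

/-- **The route target `SieveConst01651` (stmt-Parity-19185), by name**: `LowerSieveThresholdAt (1651/10000)` — for every
`ν ∈ [0.1651, 1/3)` there is `c > 0` with `IsLowerSieveConst (1/2) 0 ν c` (Ford–Maynard Theorem 7.3 (a) at `P = (1/2, 0, ν₀)`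
with the certified cone-data witness `coneCert`, then monotonicity in `ν`), obtained from the line skeleton's composition
`SieveConst01651_of_stubs`. [cite: FordMaynard2024PrimeSieves, Theorem 7.3 (a), Theorem 2.7 (b), §8.2] -/
theorem sieveConst01651_proof : SieveConst01651 :=
  Summit.Parity.GeneralizedHardyLittlewood.FordMaynardSieveConst01651SieveDecomposition.SieveConst01651_of_stubs

end Summit.Parity.GeneralizedHardyLittlewood.Theses.FordMaynardSieveConst01651

end
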